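import Mathlib
import Literature.Analysis.Complex.LaplaceHalfLine

/-!
# Solo-blind kernel #270 — Laplace transform of a semigroup read-out = resolvent read-out (`𝓛k = R`)

ENGINE-L-SPEC §13(a): the [A′] assembly integrates the causal kernel `k_V(t) = gᵀ e^{tJ} V` of the
linearised streak/roll chain and uses that its Laplace transform is the RESOLVENT read-out
`gᵀ (z − J)⁻¹ V` ("structural: Laplace half-plane of the causal kernel").  Kernel #266
(`ShiftedLineMass`) takes exactly this as the hypothesis `F s = laplaceC k s` far right, with `k` of
exponential order `γ` (`HalfLineExpBound`).  This file proves the link for a BOUNDED generator `A` in a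
complete normed algebra `𝔸` (the truncated chain with its exact tail Schur complement is such an `A`):

* `orbit A t = e^{tA}` and the integrand `Φ s A t = e^{−st} • e^{tA}`;
* `hasDerivAt_Φ` : `Φ′ = −((s•1 − A) * Φ)`;  `integral_Φ_interval` : `(s•1−A) * ∫₀ᵀ Φ = 1 − Φ(T)` (all real `T`);
* `integrableOn_Φ` and `resolvent_mul_integral`/`integral_mul_resolvent` : under the GROWTH BOUND
  `‖e^{tA}‖ ≤ K e^{γt}` (`t ≥ 0`) and `γ < Re s`, `J := ∫₀^∞ Φ` satisfies `(s•1−A) J = 1 = J (s•1−A)`;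
* `isUnit_resolvent`, `inverse_eq_integral` : hence `s•1 − A` is a unit and `(s•1−A)⁻¹ = J` (no spectral
  theory: the Laplace integral IS the two-sided inverse);
* `halfLineExpBound_readout`, `laplaceC_readout` : the scalar read-out `k(t) = ℓ(e^{tA} b)` is
  continuous of exponential order `γ` with constant `‖ℓ‖ K ‖b‖`, and
  `laplaceC k s = ℓ((s•1−A)⁻¹ b)` for `γ < Re s` — the hypotheses `hk`, `hFk` of #266/#267.
-/

namespace Summit.AnomalousDissipation.SoloBlind.LaplaceOfExp

open MeasureTheory Complex Set Filter NormedSpace Literature.Analysis.Complex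
open scoped Topology

variable {𝔸 : Type*} [NormedRing 𝔸] [NormedAlgebra ℂ 𝔸]

/-- The semigroup orbit `t ↦ e^{tA}` (real time, complex scalars). -/
noncomputable def orbit (A : 𝔸) (t : ℝ) : 𝔸 := exp ((t : ℂ) • A)

/-- The Laplace integrand `Φ(t) = e^{−st} • e^{tA}`. -/
noncomputable def Φ (s : ℂ) (A : 𝔸) (t : ℝ) : 𝔸 := cexp (-(s * t)) • orbit A t

/-- The candidate resolvent element `s•1 − A`. -/
noncomputable def resolventElt (s : ℂ) (A : 𝔸) : 𝔸 := s • (1 : 𝔸) - A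

/-- `orbit A 0 = 1`. -/
theorem orbit_zero (A : 𝔸) : orbit A 0 = 1 := by
  simp [orbit]

/-- `Φ 0 = 1`. -/
theorem Φ_zero (s : ℂ) (A : 𝔸) : Φ s A 0 = 1 := by
  simp [Φ, orbit_zero]

/-- `A` commutes with its orbit. -/
theorem commute_orbit (A : 𝔸) (t : ℝ) : Commute A (orbit A t) := by
  unfold orbit
  exact ((Commute.refl A).smul_right (t : ℂ)).exp_right

/-- `s•1 − A` commutes with the orbit. -/
theorem commute_resolventElt_orbit (s : ℂ) (A : 𝔸) (t : ℝ) :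
    Commute (resolventElt s A) (orbit A t) := by
  unfold resolventElt
  exact ((Commute.one_left _).smul_left s).sub_left (commute_orbit A t)

/-- Norm of the integrand under the growth bound: `‖Φ(t)‖ ≤ K e^{(γ − Re s)t}` for `t ≥ 0`. -/
theorem norm_Φ_le {A : 𝔸} {K γ : ℝ}
    (hK : ∀ t : ℝ, 0 ≤ t → ‖orbit A t‖ ≤ K * Real.exp (γ * t)) (s : ℂ) {t : ℝ}
    (ht : 0 ≤ t) : ‖Φ s A t‖ ≤ K * Real.exp ((γ - s.re) * t) := by
  unfold Φ
  calc ‖cexp (-(s * t)) • orbit A t‖ ≤ ‖cexp (-(s * t))‖ * ‖orbit A t‖ := norm_smul_le _ _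
    _ = Real.exp (-(s.re * t)) * ‖orbit A t‖ := by
        rw [Complex.norm_exp]; congr 1; simp [Complex.mul_re]
    _ ≤ Real.exp (-(s.re * t)) * (K * Real.exp (γ * t)) :=
        mul_le_mul_of_nonneg_left (hK t ht) (Real.exp_pos _).le
    _ = K * Real.exp ((γ - s.re) * t) := by
        rw [show (γ - s.re) * t = -(s.re * t) + γ * t by ring, Real.exp_add]; ring

/-- `Φ(T) → 0` as `T → ∞` for `Re s > γ`. -/
theorem tendsto_Φ_zero {A : 𝔸} {K γ : ℝ} {s : ℂ}
    (hK : ∀ t : ℝ, 0 ≤ t → ‖orbit A t‖ ≤ K * Real.exp (γ * t))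
    (hs : γ < s.re) : Tendsto (Φ s A) atTop (𝓝 0) := by
  have hexp : Tendsto (fun t : ℝ => K * Real.exp ((γ - s.re) * t)) atTop (𝓝 0) := by
    have h1 : Tendsto (fun t : ℝ => Real.exp ((γ - s.re) * t)) atTop (𝓝 0) := by
      have : Tendsto (fun t : ℝ => (γ - s.re) * t) atTop atBot :=
        tendsto_id.const_mul_atTop_of_neg (by linarith)
      exact Real.tendsto_exp_atBot.comp this
    simpa using h1.const_mul K
  refine squeeze_zero_norm' ?_ hexp
  filter_upwards [eventually_ge_atTop (0 : ℝ)] with t ht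
  exact norm_Φ_le hK s ht

section Complete

variable [CompleteSpace 𝔸]

/-- The orbit is continuous. -/
theorem continuous_orbit (A : 𝔸) : Continuous (orbit A) := by
  have hc : Continuous (fun x : 𝔸 => exp x) :=
    continuous_iff_continuousAt.2 fun x => (NormedSpace.exp_analytic (𝕂 := ℂ) x).continuousAt
  unfold orbit
  exact hc.comp (continuous_ofReal.smul continuous_const)

/-- The integrand is continuous. -/
theorem continuous_Φ (s : ℂ) (A : 𝔸) : Continuous (Φ s A) :=
  (continuous_cexp_neg_mul s).smul (continuous_orbit A)

/-- Derivative of the orbit: `d/dt e^{tA} = A e^{tA}`. -/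
theorem hasDerivAt_orbit (A : 𝔸) (t : ℝ) : HasDerivAt (orbit A) (A * orbit A t) t := by
  have h1 : HasDerivAt (fun y : ℝ => (y : ℂ)) 1 t := by
    simpa using (hasDerivAt_id t).ofReal_comp
  have h2 := (hasDerivAt_exp_smul_const' (𝕂 := ℂ) A (t : ℂ)).scomp t h1
  show HasDerivAt (fun y : ℝ => exp ((y : ℂ) • A)) (A * exp ((t : ℂ) • A)) t
  simpa [Function.comp_def] using h2

/-- **Derivative of the integrand**: `Φ′(t) = −((s•1 − A) Φ(t))`. -/
theorem hasDerivAt_Φ (s : ℂ) (A : 𝔸) (t : ℝ) :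
    HasDerivAt (Φ s A) (-(resolventElt s A * Φ s A t)) t := by
  have h1 := hasDerivAt_cexp_neg_mul s t
  have h2 := hasDerivAt_orbit A t
  have h := h1.smul h2
  -- h : HasDerivAt (fun y => cexp (-(s*y)) • orbit A y) (cexp (-(s*t)) • (A * orbit A t) + (-s * cexp (-(s*t))) • orbit A t) t
  refine h.congr_deriv ?_
  simp only [Φ, resolventElt, sub_mul, smul_mul_assoc, one_mul, mul_smul_comm]
  module

/-- **FTC on `[0,T]`**: `(s•1 − A) ∫₀ᵀ Φ = 1 − Φ(T)`. -/
theorem integral_Φ_interval (s : ℂ) (A : 𝔸) (T : ℝ) :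
    resolventElt s A * ∫ t in (0 : ℝ)..T, Φ s A t = 1 - Φ s A T := by
  have hint : IntervalIntegrable (fun t => -(resolventElt s A * Φ s A t)) volume 0 T :=
    ((continuous_const.mul (continuous_Φ s A)).neg).intervalIntegrable (μ := volume) 0 T
  have hftc := intervalIntegral.integral_eq_sub_of_hasDerivAt
    (fun t _ => hasDerivAt_Φ s A t) hint
  rw [Φ_zero] at hftc
  have hcomm : ∫ t in (0 : ℝ)..T, resolventElt s A * Φ s A t
      = resolventElt s A * ∫ t in (0 : ℝ)..T, Φ s A t := by
    have := (ContinuousLinearMap.mul ℂ 𝔸 (resolventElt s A)).intervalIntegral_comp_comm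
      ((continuous_Φ s A).intervalIntegrable (μ := volume) 0 T)
    simpa using this
  rw [intervalIntegral.integral_neg, hcomm] at hftc
  -- hftc : -(B * ∫ Φ) = Φ T - 1
  have := congrArg Neg.neg hftc
  simpa [neg_sub] using this

section Growth

variable {A : 𝔸} {K γ : ℝ} {s : ℂ}

/-- **Integrability** of `Φ` on `(0,∞)` for `Re s > γ`. -/
theorem integrableOn_Φ (hK : ∀ t : ℝ, 0 ≤ t → ‖orbit A t‖ ≤ K * Real.exp (γ * t))
    (hs : γ < s.re) : IntegrableOn (Φ s A) (Ioi 0) := by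
  have hdom : IntegrableOn (fun t : ℝ => K * Real.exp ((γ - s.re) * t)) (Ioi 0) :=
    (integrableOn_exp_mul_Ioi (by linarith) 0).const_mul K
  refine Integrable.mono' hdom (continuous_Φ s A).aestronglyMeasurable ?_
  exact (ae_restrict_iff' measurableSet_Ioi).2
    (Eventually.of_forall fun t ht => norm_Φ_le hK s (le_of_lt ht))

/-- **Left inverse**: `(s•1 − A) · ∫₀^∞ Φ = 1`. -/
theorem resolvent_mul_integral (hK : ∀ t : ℝ, 0 ≤ t → ‖orbit A t‖ ≤ K * Real.exp (γ * t))
    (hs : γ < s.re) : resolventElt s A * ∫ t in Ioi (0 : ℝ), Φ s A t = 1 := by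
  have hlim : Tendsto (fun T : ℝ => ∫ t in (0 : ℝ)..T, Φ s A t) atTop
      (𝓝 (∫ t in Ioi (0 : ℝ), Φ s A t)) :=
    intervalIntegral_tendsto_integral_Ioi 0 (integrableOn_Φ hK hs) tendsto_id
  have h1 : Tendsto (fun T : ℝ => resolventElt s A * ∫ t in (0 : ℝ)..T, Φ s A t) atTop
      (𝓝 (resolventElt s A * ∫ t in Ioi (0 : ℝ), Φ s A t)) :=
    hlim.const_mul _
  have h2 : Tendsto (fun T : ℝ => resolventElt s A * ∫ t in (0 : ℝ)..T, Φ s A t) atTop (𝓝 1) := by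
    have h3 : Tendsto (fun T : ℝ => (1 : 𝔸) - Φ s A T) atTop (𝓝 1) := by
      simpa using (tendsto_const_nhds (x := (1 : 𝔸))).sub (tendsto_Φ_zero hK hs)
    exact h3.congr' (Eventually.of_forall fun T => (integral_Φ_interval s A T).symm)
  exact tendsto_nhds_unique h1 h2

/-- **Right inverse**: `(∫₀^∞ Φ) · (s•1 − A) = 1` (the resolvent element commutes with the orbit). -/
theorem integral_mul_resolvent (hK : ∀ t : ℝ, 0 ≤ t → ‖orbit A t‖ ≤ K * Real.exp (γ * t))
    (hs : γ < s.re) : (∫ t in Ioi (0 : ℝ), Φ s A t) * resolventElt s A = 1 := by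
  have hcomm : ∀ t, Φ s A t * resolventElt s A = resolventElt s A * Φ s A t := by
    intro t
    unfold Φ
    rw [smul_mul_assoc, mul_smul_comm, (commute_resolventElt_orbit s A t).eq]
  have hR : (∫ t in Ioi (0 : ℝ), Φ s A t) * resolventElt s A
      = ∫ t in Ioi (0 : ℝ), Φ s A t * resolventElt s A := by
    have := ((ContinuousLinearMap.mul ℂ 𝔸).flip (resolventElt s A)).integral_comp_comm
      (integrableOn_Φ hK hs)
    simpa using this.symm
  have hL : (∫ t in Ioi (0 : ℝ), resolventElt s A * Φ s A t)
      = resolventElt s A * ∫ t in Ioi (0 : ℝ), Φ s A t := by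
    have := (ContinuousLinearMap.mul ℂ 𝔸 (resolventElt s A)).integral_comp_comm
      (integrableOn_Φ hK hs)
    simpa using this
  rw [hR]
  simp_rw [hcomm]
  rw [hL, resolvent_mul_integral hK hs]

/-- **`s•1 − A` is a unit** for `Re s > γ`. -/
theorem isUnit_resolvent (hK : ∀ t : ℝ, 0 ≤ t → ‖orbit A t‖ ≤ K * Real.exp (γ * t))
    (hs : γ < s.re) : IsUnit (resolventElt s A) :=
  ⟨⟨resolventElt s A, ∫ t in Ioi (0 : ℝ), Φ s A t, resolvent_mul_integral hK hs,
    integral_mul_resolvent hK hs⟩, rfl⟩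

/-- **The inverse is the Laplace integral**: `(s•1 − A)⁻¹ = ∫₀^∞ e^{−st} e^{tA} dt`. -/
theorem inverse_eq_integral (hK : ∀ t : ℝ, 0 ≤ t → ‖orbit A t‖ ≤ K * Real.exp (γ * t))
    (hs : γ < s.re) : Ring.inverse (resolventElt s A) = ∫ t in Ioi (0 : ℝ), Φ s A t := by
  obtain ⟨u, hu⟩ := isUnit_resolvent hK hs
  rw [← hu, Ring.inverse_unit]
  have h1 : (u : 𝔸) * ∫ t in Ioi (0 : ℝ), Φ s A t = 1 := by rw [hu]; exact resolvent_mul_integral hK hs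
  calc (↑u⁻¹ : 𝔸) = ↑u⁻¹ * ((u : 𝔸) * ∫ t in Ioi (0 : ℝ), Φ s A t) := by rw [h1, mul_one]
    _ = ∫ t in Ioi (0 : ℝ), Φ s A t := by rw [← mul_assoc, Units.inv_mul, one_mul]

/-- The scalar read-out `k(t) = ℓ(e^{tA} b)` is **continuous of exponential order `γ`** with constant
`‖ℓ‖ K ‖b‖` (hypothesis `hk` of #266/#267). -/
theorem halfLineExpBound_readout (hK : ∀ t : ℝ, 0 ≤ t → ‖orbit A t‖ ≤ K * Real.exp (γ * t))
    (ℓ : 𝔸 →L[ℂ] ℂ) (b : 𝔸) :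
    HalfLineExpBound (fun t => ℓ (orbit A t * b)) (‖ℓ‖ * K * ‖b‖) γ where
  continuous := ℓ.continuous.comp ((continuous_orbit A).mul continuous_const)
  bound := by
    intro t ht
    calc ‖ℓ (orbit A t * b)‖ ≤ ‖ℓ‖ * ‖orbit A t * b‖ := ℓ.le_opNorm _
      _ ≤ ‖ℓ‖ * (‖orbit A t‖ * ‖b‖) := by gcongr; exact norm_mul_le _ _
      _ ≤ ‖ℓ‖ * (K * Real.exp (γ * t) * ‖b‖) := by gcongr; exact hK t ht
      _ = ‖ℓ‖ * K * ‖b‖ * Real.exp (γ * t) := by ring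

/-- **`𝓛k = R`**: the Laplace transform of the read-out `k(t) = ℓ(e^{tA} b)` is the resolvent read-out
`ℓ((s•1 − A)⁻¹ b)` on the half-plane `Re s > γ` (hypothesis `hFk` of #266/#267). -/
theorem laplaceC_readout (hK : ∀ t : ℝ, 0 ≤ t → ‖orbit A t‖ ≤ K * Real.exp (γ * t))
    (hs : γ < s.re) (ℓ : 𝔸 →L[ℂ] ℂ) (b : 𝔸) :
    laplaceC (fun t => ℓ (orbit A t * b)) s = ℓ (Ring.inverse (resolventElt s A) * b) := by
  unfold laplaceC
  -- the integrand is L (Φ t) with L = ℓ ∘ (right multiplication by b)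
  set L : 𝔸 →L[ℂ] ℂ := ℓ.comp ((ContinuousLinearMap.mul ℂ 𝔸).flip b) with hLdef
  have hpt : ∀ t : ℝ, cexp (-(s * t)) * ℓ (orbit A t * b) = L (Φ s A t) := by
    intro t
    simp only [hLdef, ContinuousLinearMap.coe_comp, Function.comp_apply,
      ContinuousLinearMap.flip_apply, ContinuousLinearMap.mul_apply', Φ, map_smul, smul_eq_mul]
  simp_rw [hpt]
  rw [L.integral_comp_comm (integrableOn_Φ hK hs), ← inverse_eq_integral hK hs]
  simp [hLdef]

end Growth

end Complete

end Summit.AnomalousDissipation.SoloBlind.LaplaceOfExp
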